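import Mathlib
import HarnessLib
import Summits.BirchSwinnertonDyer.BirchSwinnertonDyer.Theses.ManinLocalTwoThree
import Summits.BirchSwinnertonDyer.BirchSwinnertonDyer.Theorems.ManinLocalTwoThreeIndexFourFullTwoTorsion
import Literature.NumberTheory.Automorphic.UnboundedDenominators

/-!
# Lines/cdivision_udc.lean — v4 (lead p1 gen 19, 2026-08-30T03:0xZ): THE c-DIVISION LINE for C2 `ManinOddAtFour` — three PRINTED stubs (CDT Thm 1.0.1 verbatim, F★, CES) and
# ONE law, the narrowest residual E-an-152e `ShimuraIndexNeFourAtFourFreyHabitat` (index-4 exclusion on the Frey habitat: FULL RATIONAL 2-TORSION, N = 2^a·m, m odd squarefree).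
#
# CHAIN (all kernel theorems, std axioms): c-division witness with ℤ-coefficients (an g44 / p2 g20–21 / p3 g18 / LEAD; `CDivisionInt.exists_cDivisionWitnessInt`) + CDT Thm 1.0.1 +
# Γ₁-Wohlfahrt (LEAD p752707) ⟹ Λ₁(f) ⊆ Λ_W for every datum ⟹ C3, C5, |c₀| = 1 at odd-square levels, c₀ ∣ 2 at 4 ∣ N, |c₁| = 1 (mod CDT Thm 1); at N = 2^a·m (m odd squarefree)
# `2 ∣ c₀` ⟺ index 4 (Λ₁ = 2Λ₀); E-an-152d (index 4 ⟹ full rational 2-torsion) is a THEOREM mod F★ ∧ CES (p2 g21 p757495 `IndexFourTwoTorsion.indexFourForcesFullRationalTwoTorsion_of_cuspRational_CES`,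
# ref1 §R212(b) route = LEAD memo v40 §2 mechanism: the rational cusp images of the optimal X₁-parametrisation cover ½Λ_W); and «E[2] ⊆ E(ℚ₂) ⟹ v₂(N) ≠ 2» (LEAD 02:00Z, ref1
# §R212 SOUND; not yet typed) makes a ≥ 3.  So the ONE open law is E-an-152e.  COMPOSITION `IndexFourTwoTorsion.maninOddAtFour_of_CDTInt_cuspRational_CES_freyHabitat`.
# HONEST FRAMING: CONDITIONAL reduction; CDT Thm 1.0.1 (JAMS 2025), F★ (Stevens 1989 Thm 1.3: cusp images of the optimal X₁-parametrisation are rational), CES (Conrad–Edixhoven–Stein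
# 2003 §6.1: existence of the optimal X₁-datum) are PRINTED, statement-only; E-an-152e OPEN (habitat by data: N = 32m, Kodaira III, tors (ℤ/2)²; diagnostics memos v40/v41);
# BSD is not proved; Manin's conjecture is not proved.
-/

set_option autoImplicit false
set_option linter.dupNamespace false

noncomputable section

open Literature.NumberTheory.EllipticCurves.ModularForms

namespace Summit.BirchSwinnertonDyer.BirchSwinnertonDyer.Cruxes.ManinOddAtFour.CDivisionUDC

/-- STUB (PRINTED) CDT Theorem 1.0.1 as printed (`CalegariDimitrovTang2025_unboundedDenominators`, ℤ-coefficients); CITE-ONLY. -/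
theorem stub_CDT : Literature.NumberTheory.Automorphic.CalegariDimitrovTang2025_unboundedDenominators := by
  sorry

/-- STUB (PRINTED) F★ `optimalGamma1Parametrization_cusp_rational` — Stevens 1989 Thm. 1.3: the optimal `X₁(N)`-parametrisation maps every cusp `γ·∞` (`γ ∈ Γ₀(N)`) to a RATIONAL
point; CITE-ONLY. -/
theorem stub_Fstar : optimalGamma1Parametrization_cusp_rational := by
  sorry

/-- STUB (PRINTED) CES `exists_optimal_gamma1ParametrizationData` — Conrad–Edixhoven–Stein 2003 §6.1 / Stevens 1989 §2: the optimal `X₁(N)`-datum of the class exists on a globally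
minimal model; CITE-ONLY. -/
theorem stub_CES : exists_optimal_gamma1ParametrizationData := by
  sorry

/-- STUB (LAW) E-an-152e `CDivisionNeron.ShimuraIndexNeFourAtFourFreyHabitat` (an g45, by name) — no lattice-optimal `X₀(N)`-datum of a globally minimal curve WITH FULL RATIONAL
2-TORSION (three `Greenberg1999.HasRationalTwoTorsionX` points), at `4 ∣ N` with no odd square dividing `N`, has `Λ₁(f) = 2Λ₀(f)`.  c-free; THE residual of the route (mod printed
facts): OPEN at 8 ∣ N, m odd squarefree, cuspidal-inertia 2-rank ≥ 2 (empirical habitat N = 32m, Kodaira III, tors = (ℤ/2)², 2182 optimal curves < 5·10⁵ all with c₀ = 1);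
necessary conditions (K1)–(K3) and the Tamagawa-evenness diagnostic in LEAD-MEMO v40 §2 / v41 §2.  Hardest (only) stub. -/
theorem stub_shimuraIndexNeFourAtFourFreyHabitat :
    Summit.BirchSwinnertonDyer.BirchSwinnertonDyer.Theorems.ManinLocalTwoThree.CDivisionNeron.ShimuraIndexNeFourAtFourFreyHabitat := by
  sorry

/-- COMPOSITION (no sorry): `IndexFourTwoTorsion.maninOddAtFour_of_CDTInt_cuspRational_CES_freyHabitat` (p2 g21, p757495). -/
theorem ManinOddAtFour_of :
    Summit.BirchSwinnertonDyer.BirchSwinnertonDyer.Theses.ManinLocalTwoThree.ManinOddAtFour :=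
  Summit.BirchSwinnertonDyer.BirchSwinnertonDyer.Theorems.ManinLocalTwoThree.IndexFourTwoTorsion.maninOddAtFour_of_CDTInt_cuspRational_CES_freyHabitat
    stub_CDT stub_Fstar stub_CES stub_shimuraIndexNeFourAtFourFreyHabitat

end Summit.BirchSwinnertonDyer.BirchSwinnertonDyer.Cruxes.ManinOddAtFour.CDivisionUDC

end
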